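import Literature.AlgebraicGeometry.Motives.MixedHodgeStructureTensor
import Literature.AlgebraicGeometry.Motives.MixedHodgeStructureDeligneIDimension
import Literature.AlgebraicGeometry.Motives.HodgeTensorHodgeNumberProofs
import HarnessLib

/-!
# Hodge numbers and weights of the tensor product of mixed Hodge structures; the pure case

For mixed `ℚ`-Hodge structures `H₁`, `H₂` on finite-dimensional spaces, the tensor product
`H₁ ⊗ H₂` (the tree's `MixedHodgeStructure.tensor`, `Motives/MixedHodgeStructureTensor.lean`;
Cattani–El Zein–Griffiths–Lê, *Hodge Theory*, §3.2.2.7 (1)) is split by the tensor product of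
Deligne's bigradings, `J^{p,q} = ⊕_{a+c=p, b+d=q} I^{a,b}(H₁) ⊗ I^{c,d}(H₂)` (Thm. 7.5.6: the
equivalence MHS ↔ bigradings is compatible with `⊗`).  Hence (the mixed analogue of Deligne,
*Hodge II*, 1.1.12, `(V ⊗ W)^{p,q} = ⊕ V^{a,b} ⊗ W^{p-a,q-b}`):

* **`MixedHodgeStructure.hodgeNumber_tensor`**:
  `h^{p,q}(H₁ ⊗ H₂) = Σ_{a,b} h^{a,b}(H₁) · h^{p-a,q-b}(H₂)`;
* `MixedHodgeStructure.IsPure.tensor`: if `H₁`, `H₂` are pure of weights `n`, `m` (as MHS) then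
  `H₁ ⊗ H₂` is pure of weight `n + m` (`W_r = Σ_{i+j=r} W_i ⊗ W_j`);
* **`HodgeStructure.toMixedHodgeStructure_tensor`**: for pure Hodge structures `H₁`, `H₂` the MHS of
  the pure tensor product `H₁ ⊗ H₂` (the tree's `HodgeStructure.tensor`, `F^p = Σ_{a+b ≥ p} F^a ⊗ F^b`)
  is the MHS tensor product of the MHS of `H₁` and `H₂` (Cattani et al., Ex. 3.2.23 (1) with
  §3.1.1.3 (1) and §3.2.2.7 (1)).

All statements are theorems; no named facts.

## References

* [CattaniElZeinGriffithsLe2014] E. Cattani et al. (eds.), *Hodge Theory* (2014), §3.1.1.3 (1),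
  §3.2.2.7 (1), Ex. 3.2.23 (1), Thm. 7.5.6.
* [DeligneHodgeII1971] P. Deligne, Théorie de Hodge II, 1.1.12, 2.1.13.
-/

noncomputable section

open scoped TensorProduct

namespace Literature.AlgebraicGeometry.Motives

namespace MixedHodgeStructure

universe u v

variable {V : Type u} [AddCommGroup V] [Module ℚ V]
variable {V' : Type v} [AddCommGroup V'] [Module ℚ V']

open Module
open HodgeStructure (tensorBaseChange)

variable (H₁ : MixedHodgeStructure V) (H₂ : MixedHodgeStructure V')

/-! ### Weights -/

/-- **The tensor product of pure MHS is pure**: if `W(H₁)` jumps only at `n` and `W(H₂)` only at `m`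
then `W_r(H₁ ⊗ H₂) = Σ_{i+j=r} W_i ⊗ W_j` jumps only at `n + m`.
[cite: CattaniElZeinGriffithsLe2014, §3.2.2.7] -/
theorem IsPure.tensor [FiniteDimensional ℚ V] [FiniteDimensional ℚ V'] {H₁ : MixedHodgeStructure V}
    {H₂ : MixedHodgeStructure V'} {n m : ℤ} (h₁ : H₁.IsPure n) (h₂ : H₂.IsPure m) :
    (tensor H₁ H₂).IsPure (n + m) := by
  refine ⟨fun k hk => ?_, fun k hk => ?_⟩
  · rw [tensor_W, eq_bot_iff]
    refine iSup₂_le fun ij (hij : ij.1 + ij.2 = k) => ?_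
    by_cases hi : ij.1 < n
    · rw [h₁.1 _ hi, Submodule.map₂_bot_left]
    · rw [h₂.1 _ (show ij.2 < m by omega), Submodule.map₂_bot_right]
  · rw [tensor_W, eq_top_iff]
    refine le_iSup₂_of_le (f := fun (ij : ℤ × ℤ) (_ : ij ∈ {ij : ℤ × ℤ | ij.1 + ij.2 = k}) =>
        Submodule.map₂ (TensorProduct.mk ℚ V V') (H₁.W ij.1) (H₂.W ij.2)) (n, k - n)
      (show n + (k - n) = k by omega) ?_
    simp only [h₁.2 n le_rfl, h₂.2 (k - n) (by omega), TensorProduct.map₂_mk_top_top_eq_top, le_refl]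

/-- A pure MHS of weight `n` has the trivial weight filtration jumping at `n`. [folklore] -/
private theorem W_eq_trivialWeightFiltration_of_isPure {H : MixedHodgeStructure V} {n : ℤ}
    (h : H.IsPure n) (k : ℤ) : H.W k = HodgeStructure.trivialWeightFiltration V n k := by
  by_cases hk : k < n
  · rw [h.1 k hk, HodgeStructure.trivialWeightFiltration_of_lt hk]
  · rw [h.2 k (not_lt.1 hk), HodgeStructure.trivialWeightFiltration_of_le (not_lt.1 hk)]

/-! ### Hodge numbers -/

/-- `J^{p,q}(H₁ ⊗ H₂) = ⊕_{(a,b) ∈ T} I^{a,b}(H₁) ⊗ I^{p-a,q-b}(H₂)` for any finite set `T` of bidegrees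
outside which `I^{a,b}(H₁) = 0`. [cite: CattaniElZeinGriffithsLe2014, Thm. 7.5.6] -/
theorem tensorBigrading_eq_biSup_finset (p q : ℤ) (T : Finset (ℤ × ℤ))
    (hT : ∀ ab ∉ T, H₁.deligneFamily ab = ⊥) :
    tensorBigrading H₁ H₂ (p, q) = ⨆ ab ∈ T, tensorPiece H₁ H₂ (ab, (p - ab.1, q - ab.2)) := by
  apply le_antisymm
  · refine iSup₂_le fun αβ hαβ => ?_
    have h : (αβ.1.1 + αβ.2.1, αβ.1.2 + αβ.2.2) = (p, q) := hαβ
    simp only [Prod.mk.injEq] at h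
    by_cases hab : αβ.1 ∈ T
    · have e : αβ = (αβ.1, (p - αβ.1.1, q - αβ.1.2)) :=
        Prod.ext rfl (Prod.ext (show αβ.2.1 = p - αβ.1.1 by omega) (show αβ.2.2 = q - αβ.1.2 by omega))
      rw [e]
      exact le_biSup (fun ab : ℤ × ℤ => tensorPiece H₁ H₂ (ab, (p - ab.1, q - ab.2))) hab
    · rw [tensorPiece, hT _ hab, Submodule.map₂_bot_left, Submodule.comap_bot, LinearEquiv.ker]
      exact bot_le
  · refine iSup₂_le fun ab _ => ?_
    exact le_biSup (tensorPiece H₁ H₂) (i := (ab, (p - ab.1, q - ab.2)))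
      (show (ab.1 + (p - ab.1), ab.2 + (q - ab.2)) = (p, q) from
        Prod.ext (show ab.1 + (p - ab.1) = p by omega) (show ab.2 + (q - ab.2) = q by omega))

section HodgeNumbers

variable [FiniteDimensional ℚ V] [FiniteDimensional ℚ V']

/-- `dim_ℂ (I^{a,b}(H₁) ⊗ I^{c,d}(H₂)) = h^{a,b}(H₁) · h^{c,d}(H₂)` (`dim (P ⊗ Q) = dim P · dim Q` and
`dim I^{p,q} = h^{p,q}`, Prop. 3.2.19). [cite: CattaniElZeinGriffithsLe2014, Prop. 3.2.19] -/
theorem finrank_tensorPiece (αβ : (ℤ × ℤ) × (ℤ × ℤ)) :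
    finrank ℂ (tensorPiece H₁ H₂ αβ) =
      H₁.hodgeNumber αβ.1.1 αβ.1.2 * H₂.hodgeNumber αβ.2.1 αβ.2.2 := by
  rw [tensorPiece, Submodule.comap_equiv_eq_map_symm, LinearEquiv.finrank_map_eq, finrank_map₂_mk,
    ← finrank_deligneI_eq_hodgeNumber, ← finrank_deligneI_eq_hodgeNumber]
  rfl

/-- **Hodge numbers of the tensor product of mixed Hodge structures**:
`h^{p,q}(H₁ ⊗ H₂) = Σ_{a,b} h^{a,b}(H₁) · h^{p-a,q-b}(H₂)` — the dimension of
`J^{p,q} = ⊕_{a,b} I^{a,b}(H₁) ⊗ I^{p-a,q-b}(H₂)` (`hodgeNumber_tensor_eq_finrank`, independence of the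
pieces, `dim I^{a,b} = h^{a,b}`); the mixed analogue of Deligne, Hodge II, 1.1.12 (the tree's pure
`HodgeStructure.hodgeNumber_tensor_holds`). [cite: CattaniElZeinGriffithsLe2014, §3.2.2.7 and Thm. 7.5.6]
[cite: DeligneHodgeII1971, 1.1.12] -/
theorem hodgeNumber_tensor (p q : ℤ) :
    (tensor H₁ H₂).hodgeNumber p q =
      ∑ᶠ (a : ℤ) (b : ℤ), H₁.hodgeNumber a b * H₂.hodgeNumber (p - a) (q - b) := by
  classical
  obtain ⟨T, hT⟩ : ∃ T : Finset (ℤ × ℤ), ∀ ab ∉ T, H₁.deligneFamily ab = ⊥ :=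
    ⟨H₁.finite_setOf_deligneFamily_ne_bot.toFinset, fun ab hab => by
      by_contra h
      exact hab ((Set.Finite.mem_toFinset _).2 h)⟩
  -- the independent family `(a,b) ↦ I^{a,b} ⊗ I^{p-a,q-b}`
  have hind : iSupIndep fun ab : ℤ × ℤ => tensorPiece H₁ H₂ (ab, (p - ab.1, q - ab.2)) :=
    (iSupIndep_tensorPiece H₁ H₂).comp (f := fun ab : ℤ × ℤ => (ab, (p - ab.1, q - ab.2)))
      fun x y h => (Prod.ext_iff.1 h).1
  rw [hodgeNumber_tensor_eq_finrank, tensorBigrading_eq_biSup_finset H₁ H₂ p q T hT,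
    finrank_biSup_eq_sum_of_iSupIndep hind]
  -- the right-hand side is supported on `T`
  have hsupp : Function.support
      (fun ab : ℤ × ℤ => H₁.hodgeNumber ab.1 ab.2 * H₂.hodgeNumber (p - ab.1) (q - ab.2)) ⊆ ↑T := by
    intro ab hab
    by_contra habT
    refine (Function.mem_support.1 hab) ?_
    show H₁.hodgeNumber ab.1 ab.2 * _ = 0
    rw [← finrank_deligneI_eq_hodgeNumber, show H₁.deligneI ab.1 ab.2 = ⊥ from hT ab habT, finrank_bot,
      zero_mul]
  rw [show (∑ᶠ (a : ℤ) (b : ℤ), H₁.hodgeNumber a b * H₂.hodgeNumber (p - a) (q - b)) =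
      ∑ ab ∈ T, H₁.hodgeNumber ab.1 ab.2 * H₂.hodgeNumber (p - ab.1) (q - ab.2) from
    (finsum_curry (fun ab : ℤ × ℤ => H₁.hodgeNumber ab.1 ab.2 * H₂.hodgeNumber (p - ab.1) (q - ab.2))
      (T.finite_toSet.subset hsupp)).symm.trans (finsum_eq_sum_of_support_subset _ hsupp)]
  exact Finset.sum_congr rfl fun ab _ => finrank_tensorPiece H₁ H₂ _

/-- `h^{p,q}(H₁ ⊗ H₂)` vanishes unless some `h^{a,b}(H₁) · h^{p-a,q-b}(H₂) ≠ 0`. [cite: CattaniElZeinGriffithsLe2014, §3.2.2.7] -/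
theorem hodgeNumber_tensor_eq_zero (p q : ℤ)
    (h : ∀ a b : ℤ, H₁.hodgeNumber a b * H₂.hodgeNumber (p - a) (q - b) = 0) :
    (tensor H₁ H₂).hodgeNumber p q = 0 := by
  rw [hodgeNumber_tensor]
  simp_rw [h, finsum_zero]

end HodgeNumbers

/-! ### The pure case -/

/-- **The MHS of the tensor product of pure Hodge structures is the tensor product of their MHS**:
for `H₁`, `H₂` pure of weights `n`, `m`, the pure tensor product `H₁ ⊗ H₂` (weight `n + m`,
`F^p(V ⊗ V')_ℂ = Σ_{a+b ≥ p} F^a ⊗ F^b`, §3.1.1.3 (1); the tree's `HodgeStructure.tensor`) regarded as an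
MHS (Ex. 3.2.23 (1)) equals the MHS tensor product (§3.2.2.7 (1)): the weight filtrations are both
trivial at `n + m`, and `Σ_{a+b ≥ p} F^a ⊗ F^b = Σ_{a+b = p} F^a ⊗ F^b` as `F` is decreasing.
[cite: CattaniElZeinGriffithsLe2014, §3.2.2.7 and Ex. 3.2.23 (1)] -/
theorem _root_.Literature.AlgebraicGeometry.Motives.HodgeStructure.toMixedHodgeStructure_tensor
    [HodgeTensorFacts.{u, v}] [FiniteDimensional ℚ V] [FiniteDimensional ℚ V'] {n m : ℤ}
    (H₁ : HodgeStructure V n) (H₂ : HodgeStructure V' m) :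
    (H₁.tensor H₂).toMixedHodgeStructure =
      tensor H₁.toMixedHodgeStructure H₂.toMixedHodgeStructure := by
  refine ext_of_W_F (funext fun r => ?_) (funext fun r => ?_)
  · rw [HodgeStructure.toMixedHodgeStructure_W,
      W_eq_trivialWeightFiltration_of_isPure (H₁.isPure_toMixedHodgeStructure.tensor
        H₂.isPure_toMixedHodgeStructure) r]
  · rw [HodgeStructure.toMixedHodgeStructure_F, HodgeStructure.tensor_F, tensor_F,
      HodgeStructure.tensorFiltration]
    simp only [TensorProduct.range_mapIncl, HodgeStructure.toMixedHodgeStructure_F]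
    apply le_antisymm
    · refine iSup_le fun a => iSup_le fun b => iSup_le fun hab => ?_
      refine (Submodule.comap_mono (Submodule.map₂_le_map₂_right
        (H₂.antitone_F (show r - a ≤ b by omega)))).trans ?_
      exact le_biSup (fun ac : ℤ × ℤ =>
          (Submodule.map₂ (TensorProduct.mk ℂ (ℂ ⊗[ℚ] V) (ℂ ⊗[ℚ] V')) (H₁.F ac.1) (H₂.F ac.2)).comap
            (tensorBaseChange V V' : ℂ ⊗[ℚ] (V ⊗[ℚ] V') →ₗ[ℂ] _)) (i := (a, r - a))
        (show a + (r - a) = r by omega)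
    · refine iSup₂_le fun ac (hac : ac.1 + ac.2 = r) => ?_
      exact le_iSup_of_le ac.1 (le_iSup_of_le ac.2 (le_iSup_of_le (show r ≤ ac.1 + ac.2 by omega) le_rfl))

end MixedHodgeStructure

end Literature.AlgebraicGeometry.Motives

end
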